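import Summits.HubbardSuperconductivity.HubbardSuperconductivity.Theses.WidthHaldane

/-!
# `Lines/birth.lean` — birth-certificate skeleton (BC3) for crux `WidthHaldaneBridge`
(stmt-HubbardSuperconductivity-16311, rank-2 crux of route `WidthHaldane`, sub `HubbardSuperconductivity`)

Registrar `planner-skel-stmt-HubbardSuperconductivity-16311-0`, 2026-08-17 (mode skeleton-register; no new routes,
no proving beyond the assembly). The crux is FIXED: its decl and signature are the route's
(`Summit.HubbardSuperconductivity.HubbardSuperconductivity.Theses.WidthHaldane.WidthHaldaneBridge`, rev 5, carrier-free
typing). This file cuts it along the seam the route header itself names (TWO-LAYER PLAN: "Bridge ⇐ NarrowBase →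
SeamDoubling → Bridge … plus an unequal-width variant to reach non-dyadic widths; losses summable along the binary
merge tree give width-uniform constants") into TWO named stubs, and PROVES the climb — the induction on the width with
a summable loss budget — as the assembly (`family_of_stubs`, ≈ 120 lines, no `sorry`), so that
`WidthHaldaneBridge_of : WidthHaldaneBridge := WidthHaldaneBridge_of_stubs stub_perWidthHaldaneLaw stub_seamGluing`
concludes the route decl BY NAME.

## The two local predicates (verbatim slices of the crux signature — same `let`s, same binder names)

* `UniformThermo U δ d₀ k₀ M₁ L₀` — the crux's HYPOTHESIS: width-uniform twist stiffness `d₀ ≤ ρ̃_{L,M}` and inverse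
  pair compressibility `0 < ẽ″_{L,M} ≤ k₀` on every even tube `M₁ ≤ M ≤ L`, `L ≥ L₀`, every labelling.
* `LawAt U δ M Ξ A R L₁` — the crux's CONCLUSION AT ONE WIDTH `M`: for every even `L ≥ max(L₁, M)`, every labelling,
  every normalised `(N_{L,M}, S^z = 0)` sector ground state `ψ` and every long-cycle displacement `r` with
  `R ≤ r̂ = min(r, L−r)`: `A·L·M²·r̂^{−Ξ·√(ẽ″_{L,M}/ρ̃_{L,M})/M} ≤ G_ψ(r)` (the Haldane-form law with prefactor `Ξ`,
  amplitude `A`, thresholds `R`, `L₁`).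
  So the crux reads: `∀ (U,δ) window, ∀ data, UniformThermo → ∃ Ξ A R M₂ L₁, ∀ even M ≥ M₂, LawAt U δ M Ξ A R L₁`
  (binder shuffling only; certified by the `example` after `WidthHaldaneBridge_of_stubs`).

## Stubs (sorries live ONLY here)

* `stub_perWidthHaldaneLaw` — NARROW BASE, PER WIDTH (Luther–Emery + Haldane at fixed width): under `UniformThermo`,
  beyond some width `M₂` EVERY FIXED even width `M` obeys the Haldane-form law with ITS OWN constants
  `Ξ_M, A_M, R_M, L_M` (no uniformity in `M` claimed). This is the finitely-many-bands, 1+1-dimensional statement: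
  a width-`M` Hubbard tube is an `M`-band 1D Fermi system; stiff + compressible ⇒ one gapless charge mode whose
  pair exponent is tied to the thermodynamic Luttinger number `K̂_{L,M} = M·√(ρ̃/ẽ″)` (constructive fermionic RG /
  Ward identities per width: [Mastropietro2005], [BenfattoFalcoMastropietro2010], [BenfattoMastropietro2011];
  C1S0 flow of N-leg ladders [LinBalentsFisher1997]; M = 2 numerics [DolfiEtAl2015]). Size XL per width, but
  no dimensional crossover inside it. Why it might fail: some fixed width is C1Sn / CEX (q_y ≠ 0 condensate) at the
  given (U, δ) although stiff and compressible — then no B1g column law at that width (hence the free floor `M₂`).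
* `stub_seamGluing` — SEAM DOUBLING WITH SUMMABLE UNIVERSALITY DEFECT (the width climbs): under `UniformThermo`
  there are `c ≥ 0` and floors `M₂, R₀, L₂` such that for near-equal even widths `M₂ ≤ M' ≤ M'' ≤ M' + 2`, if
  both widths obey the law with common constants `(Ξ, A, R ≥ R₀, L₁ ≥ L₂)` then the glued width `M' + M''` obeys it
  with prefactor `Ξ·e^{c/M'}` and amplitude `A·e^{−c/M'}` and the SAME thresholds `R, L₁` — two Luther–Emery tubes
  of Luttinger numbers `K̂' ∝ M'`, `K̂'' ∝ M''` coupled along the two seam bond-rows lock their relative charge phase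
  (pair tunnelling strongly relevant, dimension `~ 1/K̂ ≪ 2`; single-electron tunnelling spin-gapped
  [EmeryKivelsonZachar1997], [ArrigoniFradkinKivelson2004]); the total mode has `K̂ ≥ (K̂' + K̂'')(1 − O(1/K̂'))`
  and the column amplitude adds coherently up to `1 − O(1/K̂')`; the healing length of the seam is `O(1)` in the deep
  KT regime [FrohlichSpencerKT1981], whence unchanged `R, L₁`. Size XL. Why it might fail: the loss per gluing may
  not be `O(1/M')` uniformly in `L` (seam healing length growing with the width, or open-vs-periodic transverse
  boundary effects in the B1g structure at small `M'`), or the thresholds `R, L₁` may have to grow at each level.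

Neither stub is the crux or the summit in costume (BC3 probes, planner folder `bc/`, quoted in NOTES.md): the
per-width law has width-dependent constants (the crux is exactly the uniformity), the gluing lemma has no base;
`stub → WidthHaldaneBridge` and `stub → HubbardSuperconductivity` by `first | exact? | simpa using h | simpa | aesop`
FAIL for both stubs (4/4); control `WidthHaldaneBridge → WidthHaldaneBridge` succeeds.

## Assembly (kernel-checked, no `sorry`; the mathematics of "losses summable along the merge tree")

`family_of_stubs`: fix `(U, δ, d₀, k₀, M₁, L₀)` and `UniformThermo`. Take an even base floor `Ms ≥ max(M₂ᵃ, M₂ᵇ, 2)`;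
`window_uniform` merges the finitely many per-width laws of the base window `[Ms, 2Ms)` into common constants
`(Ξw, Aw, Rw ≥ 1, Lw)` (max/min, `lawAt_mono`); raise the thresholds once to `Rs = max Rw R₀`, `Ls = max Lw L₂`.
POTENTIAL `f(m) := F − 6c/m`, `F := 6c/Ms` (`0 ≤ f ≤ F` on `m ≥ Ms`, increasing). CLAIM by strong induction on `M`:
every even `M ≥ Ms` obeys `LawAt U δ M (Ξw·e^{f(M)}) (Aw·e^{−f(M)}) Rs Ls`. Base window: `f ≥ 0`. Step `M ≥ 2Ms`:
split `M = M' + M''`, `M' := 2⌊M/4⌋`, `M'' := M − M'` (both even, `Ms ≤ M' ≤ M'' ≤ M' + 2`, both `< M`); induction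
hypotheses at `M', M''`, raised to the common potential `f(M'')`; `stub_seamGluing` gives the law at `M` with
`(Ξw·e^{f(M'') + c/M'}, Aw·e^{−f(M'') − c/M'})`; the budget inequality `f(M'') + c/M' ≤ f(M)` (`key_ineq`:
`c/M' + 6c/M ≤ 6c/M''` from `M'' ≤ M' + 2`, `M' ≥ 2`) closes the step by `lawAt_mono`. Finally `f ≤ F` gives the
UNIFORM constants `(Ξw·e^{F}, Aw·e^{−F}, Rs, Ms, Ls)`. `WidthHaldaneBridge_of_stubs` restates this as the crux,
VERBATIM (binder shuffling + `dsimp only` ζ-unfolding of the shared `let`s), and `WidthHaldaneBridge_of` feeds the two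
stubs. Both stubs are load-bearing (drop the base and the induction has no start; drop the gluing and nothing is
uniform in the width).

Disproof used: none relevant (no `Disproof.lean` / Negative lemma exists for this crux as of 2026-08-17; the negatives
index of the summit — BreathingSelfDual at L = 2, KlsOrderOpenness — does not touch tubes, exponents or thermodynamic
Luttinger numbers).
-/

namespace Summit.HubbardSuperconductivity.HubbardSuperconductivity.Cruxes.WidthHaldaneBridge.Birth

open scoped BigOperators Topology Manifold Classical MeasureTheory ProbabilityTheory Matrix InnerProductSpace ComplexConjugate ContinuousMap
open Filter Set Function TopologicalSpace MeasureTheory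
open Literature.Hubbard
open Summit.HubbardSuperconductivity.HubbardSuperconductivity.Theses.WidthHaldane (WidthHaldaneBridge)

/-- The crux's HYPOTHESIS (verbatim slice): width-uniform twist stiffness per site `d₀ ≤ ρ̃_{L,M}(U,δ)` and inverse
pair compressibility `0 < ẽ″_{L,M}(U,δ) ≤ k₀` of the pure Hubbard tubes, all even `M₁ ≤ M ≤ L`, `L ≥ L₀`, every
linearly ordered labelling `e : Λ ≃ ℤ/L × ℤ/M`. -/
def UniformThermo (U δ d₀ k₀ : ℝ) (M₁ L₀ : ℕ) : Prop :=
  open Matrix Literature.MathematicalPhysics.QuantumLattice in let H0 : ∀ (L M : ℕ) (Λ : Type) [LinearOrder Λ] [Fintype Λ], (Λ ≃ ZMod L × ZMod M) → ℝ → Matrix (Finset (Orb Λ)) (Finset (Orb Λ)) ℂ := fun _ _ Λ _ _ e U => hamiltonian (SimpleGraph.fromRel fun x y : Λ => y = e.symm ((e x).1 + 1, (e x).2) ∨ y = e.symm ((e x).1, (e x).2 + 1)) 1 U; let Tw : ∀ (L M : ℕ) [NeZero L] [NeZero M] (Λ : Type) [LinearOrder Λ] [Fintype Λ], (Λ ≃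 ZMod L × ZMod M) → ℝ → Matrix (Finset (Orb Λ)) (Finset (Orb Λ)) ℂ := fun _ M _ _ _ _ _ e θ => ∑ b : ZMod M, ∑ σ : Fin 2, ((1 - Complex.exp (Complex.I * θ)) • (creation (orb (e.symm (0, b)) σ) * annihilation (orb (e.symm (-1, b)) σ)) + (1 - Complex.exp (-(Complex.I * θ))) • (creation (orb (e.symm (-1, b)) σ) * annihilation (orb (e.symm (0, b)) σ))); let E : ∀ (L M : ℕ) [NeZero L] [NeZero M] (Λ : Type) [LinearOrder Λ] [Fintype Λ], (Λ ≃ ZMod L × ZMod M) → ℝ → ℝ → ℕ → ℝ := fun L M _ _ Λ _ _ e U θ N => (H0 L M Λ e U + Tw L M Λ e θ).minEnergyOn (szSector N 0); let Np : ℕ → ℕ → ℝ → ℕ := fun L M δ => 2 * ⌊(1 - δ) * ((L : ℝ) * (M : ℝ)) / 2⌋₊; let stiff : ∀ (L M : ℕ) [NeZero L] [NeZero M] (Λ : Type) [LinearOrder Λ] [Fintype Λ], (Λ ≃ ZMod L × ZMod M) → ℝ → ℝ → ℝ := fun L M _ _ Λ _ _ e U δ => 2 * (L : ℝ) * (E L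 M Λ e U (Real.pi / 3) (Np L M δ) - E L M Λ e U 0 (Np L M δ)) / ((Real.pi / 3) ^ 2 * (M : ℝ)); let icomp : ∀ (L M : ℕ) [NeZero L] [NeZero M] (Λ : Type) [LinearOrder Λ] [Fintype Λ], (Λ ≃ ZMod L × ZMod M) → ℝ → ℝ → ℝ := fun L M _ _ Λ _ _ e U δ => (L : ℝ) * (M : ℝ) * (E L M Λ e U 0 (Np L M δ + 2) + E L M Λ e U 0 (Np L M δ - 2) - 2 * E L M Λ e U 0 (Np L M δ)) / 4; ∀ (L M : ℕ) [NeZero L] [NeZero M], Even L → Even M → M₁ ≤ M → M ≤ L → L₀ ≤ L → ∀ (Λ : Type) [LinearOrder Λ] [Fintype Λ] (e : Λ ≃ ZMod L × ZMod M), d₀ ≤ stiff L M Λ e U δ ∧ 0 < icomp L M Λ e U δ ∧ icomp L M Λ e U δ ≤ k₀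

/-- The crux's CONCLUSION AT ONE WIDTH `M` with constants `(Ξ, A, R, L₁)` (verbatim slice, width specialised):
the Haldane-form column-pair law `A·L·M²·r̂^{−Ξ·√(ẽ″_{L,M}/ρ̃_{L,M})/M} ≤ G_ψ(r)` for every even `L ≥ L₁` with
`M ≤ L`, every labelling, every normalised `(N_{L,M}, S^z=0)` sector ground state `ψ`, every `r` with `R ≤ r̂`. -/
def LawAt (U δ : ℝ) (M : ℕ) (Ξ A : ℝ) (R L₁ : ℕ) : Prop :=
  open Matrix Literature.MathematicalPhysics.QuantumLattice in let H0 : ∀ (L M : ℕ) (Λ : Type) [LinearOrder Λ] [Fintype Λ], (Λ ≃ ZMod L × ZMod M) → ℝ → Matrix (Finset (Orb Λ)) (Finset (Orb Λ)) ℂ := fun _ _ Λ _ _ e U => hamiltonian (SimpleGraph.fromRel fun x y : Λ => y = e.symm ((e x).1 + 1, (e x).2) ∨ y = e.symm ((e x).1, (e x).2 + 1)) 1 U; let Tw : ∀ (L M : ℕ) [NeZero L] [NeZero M] (Λ : Type) [LinearOrder Λ] [Fintype Λ], (Λ ≃ ZMod L × ZMod M) → ℝ → Matrix (Finset (Orb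 Λ)) (Finset (Orb Λ)) ℂ := fun _ M _ _ _ _ _ e θ => ∑ b : ZMod M, ∑ σ : Fin 2, ((1 - Complex.exp (Complex.I * θ)) • (creation (orb (e.symm (0, b)) σ) * annihilation (orb (e.symm (-1, b)) σ)) + (1 - Complex.exp (-(Complex.I * θ))) • (creation (orb (e.symm (-1, b)) σ) * annihilation (orb (e.symm (0, b)) σ))); let E : ∀ (L M : ℕ) [NeZero L] [NeZero M] (Λ : Type) [LinearOrder Λ] [Fintype Λ], (Λ ≃ ZMod L × ZMod M) → ℝ → ℝ → ℕ → ℝ := fun L M _ _ Λ _ _ e U θ N => (H0 L M Λ e U + Tw L M Λ e θ).minEnergyOn (szSector N 0); let Np : ℕ → ℕ → ℝ → ℕ := fun L M δ => 2 * ⌊(1 - δ) * ((L : ℝ) * (M : ℝ)) / 2⌋₊; let stiff : ∀ (L M : ℕ) [NeZero L] [NeZero M] (Λ : Type) [LinearOrder Λ] [Fintype Λ], (Λ ≃ ZMod L × ZMod M) → ℝ → ℝ → ℝ := fun L M _ _ Λ _ _ e U δ => 2 * (L : ℝ) * (E L M Λ e U (Real.pi / 3) (Np L M δ) - E L M Λ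 e U 0 (Np L M δ)) / ((Real.pi / 3) ^ 2 * (M : ℝ)); let icomp : ∀ (L M : ℕ) [NeZero L] [NeZero M] (Λ : Type) [LinearOrder Λ] [Fintype Λ], (Λ ≃ ZMod L × ZMod M) → ℝ → ℝ → ℝ := fun L M _ _ Λ _ _ e U δ => (L : ℝ) * (M : ℝ) * (E L M Λ e U 0 (Np L M δ + 2) + E L M Λ e U 0 (Np L M δ - 2) - 2 * E L M Λ e U 0 (Np L M δ)) / 4; let P : ∀ (L M : ℕ) (Λ : Type) [LinearOrder Λ] [Fintype Λ], (Λ ≃ ZMod L × ZMod M) → Λ → Matrix (Finset (Orb Λ)) (Finset (Orb Λ)) ℂ := fun _ _ Λ _ _ e x => ∑ j : Fin 4, (((![1, 1, -1, -1] : Fin 4 → ℝ) j / Real.sqrt 2 : ℝ) : ℂ) • (annihilation (orb x 0) * annihilation (orb ((![e.symm ((e x).1 + 1, (e x).2), e.symm ((e x).1 - 1, (e x).2), e.symm ((e x).1, (e x).2 + 1), e.symm ((e x).1, (e x).2 - 1)] : Fin 4 → Λ) j) 1) - annihilation (orb x 1) * annihilation (orb ((![e.symm ((e x).1 + 1, (e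 x).2), e.symm ((e x).1 - 1, (e x).2), e.symm ((e x).1, (e x).2 + 1), e.symm ((e x).1, (e x).2 - 1)] : Fin 4 → Λ) j) 0)); let G : ∀ (L M : ℕ) [NeZero L] [NeZero M] (Λ : Type) [LinearOrder Λ] [Fintype Λ], (Λ ≃ ZMod L × ZMod M) → Fock (Orb Λ) → ZMod L → ℝ := fun L M _ _ Λ _ _ e ψ r => ∑ a : ZMod L, (expect ((∑ b : ZMod M, P L M Λ e (e.symm (a, b)))ᴴ * (∑ b : ZMod M, P L M Λ e (e.symm (a + r, b)))) ψ).re; ∀ (L : ℕ) [NeZero L] [NeZero M], Even L → M ≤ L → L₁ ≤ L → ∀ (Λ : Type) [LinearOrder Λ] [Fintype Λ] (e : Λ ≃ ZMod L × ZMod M), ∀ ψ : Fock (Orb Λ), star ψ ⬝ᵥ ψ = 1 → IsGroundStateInSector (H0 L M Λ e U) (Np L M δ) 0 ψ → ∀ r : ZMod L, R ≤ r.val → r.val + R ≤ L → A * (L : ℝ) * (M : ℝ) ^ 2 * ((min r.val (L - r.val) : ℕ) : ℝ) ^ (-(Ξ * Real.sqrt (icomp L M Λ e U δ / stiff L M Λ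 e U δ) / (M : ℝ))) ≤ G L M Λ e ψ r

/-! ## Stubs (the only `sorry`s of this file) -/

/-- STUB 1 — NARROW BASE, PER WIDTH (Luther–Emery liquid + Haldane relation at FIXED width; constants may depend on
the width). [Mastropietro2005, BenfattoFalcoMastropietro2010, BenfattoMastropietro2011, LinBalentsFisher1997,
DolfiEtAl2015] -/
theorem stub_perWidthHaldaneLaw :
    ∀ U : ℝ, 0 < U → ∀ δ ∈ Set.Ioo (0 : ℝ) (3 / 10), ∀ (d₀ k₀ : ℝ) (M₁ L₀ : ℕ), 0 < d₀ →
      UniformThermo U δ d₀ k₀ M₁ L₀ →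
        ∃ M₂ : ℕ, ∀ M : ℕ, Even M → M₂ ≤ M →
          ∃ Ξ : ℝ, 0 < Ξ ∧ ∃ A : ℝ, 0 < A ∧ ∃ R L₁ : ℕ, LawAt U δ M Ξ A R L₁ := by
  sorry

/-- STUB 2 — SEAM GLUING with summable universality defect (two near-equal Luther–Emery tubes glued along their two
seams: prefactor `Ξ ↦ Ξ·e^{c/M'}`, amplitude `A ↦ A·e^{−c/M'}`, thresholds unchanged).
[EmeryKivelsonZachar1997, ArrigoniFradkinKivelson2004, FrohlichSpencerKT1981, LinBalentsFisher1997] -/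
theorem stub_seamGluing :
    ∀ U : ℝ, 0 < U → ∀ δ ∈ Set.Ioo (0 : ℝ) (3 / 10), ∀ (d₀ k₀ : ℝ) (M₁ L₀ : ℕ), 0 < d₀ →
      UniformThermo U δ d₀ k₀ M₁ L₀ →
        ∃ c : ℝ, 0 ≤ c ∧ ∃ M₂ R₀ L₂ : ℕ, ∀ M' M'' : ℕ, Even M' → Even M'' → M₂ ≤ M' → M' ≤ M'' →
          M'' ≤ M' + 2 → ∀ (Ξ A : ℝ) (R L₁ : ℕ), 0 < Ξ → 0 < A → R₀ ≤ R → L₂ ≤ L₁ →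
            LawAt U δ M' Ξ A R L₁ → LawAt U δ M'' Ξ A R L₁ →
              LawAt U δ (M' + M'') (Ξ * Real.exp (c / (M' : ℝ))) (A * Real.exp (-(c / (M' : ℝ)))) R L₁ := by
  sorry

/-! ## Real-arithmetic cores (instantiated by unification against the ζ-expanded law) -/

/-- Weakening the one-width inequality: larger prefactor, smaller non-negative amplitude (`r̂ ≥ 1`). -/
theorem core_mono {A A' Ξ Ξ' Lr Msq x s Mr Gv : ℝ}
    (h : A * Lr * Msq * x ^ (-(Ξ * s / Mr)) ≤ Gv) (hΞ : Ξ ≤ Ξ') (hA : A' ≤ A) (hA' : 0 ≤ A')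
    (hx : 1 ≤ x) (hs : 0 ≤ s) (hMr : 0 < Mr) (hLr : 0 ≤ Lr) (hMsq : 0 ≤ Msq) :
    A' * Lr * Msq * x ^ (-(Ξ' * s / Mr)) ≤ Gv := by
  have hX : 0 ≤ x ^ (-(Ξ' * s / Mr)) := Real.rpow_nonneg (zero_le_one.trans hx) _
  have h1 : x ^ (-(Ξ' * s / Mr)) ≤ x ^ (-(Ξ * s / Mr)) := by
    apply Real.rpow_le_rpow_of_exponent_le hx
    have : Ξ * s / Mr ≤ Ξ' * s / Mr :=
      div_le_div_of_nonneg_right (mul_le_mul_of_nonneg_right hΞ hs) hMr.le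
    linarith
  have step1 : A' * Lr * Msq * x ^ (-(Ξ' * s / Mr)) ≤ A * Lr * Msq * x ^ (-(Ξ' * s / Mr)) := by
    apply mul_le_mul_of_nonneg_right _ hX
    apply mul_le_mul_of_nonneg_right _ hMsq
    exact mul_le_mul_of_nonneg_right hA hLr
  have hALM : 0 ≤ A * Lr * Msq := mul_nonneg (mul_nonneg (hA'.trans hA) hLr) hMsq
  have step2 : A * Lr * Msq * x ^ (-(Ξ' * s / Mr)) ≤ A * Lr * Msq * x ^ (-(Ξ * s / Mr)) :=
    mul_le_mul_of_nonneg_left h1 hALM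
  exact step1.trans (step2.trans h)

/-- The loss budget of one gluing fits the potential `f(m) = F − 6c/m`: `c/M' + 6c/M ≤ 6c/M''` for near-equal
widths `2 ≤ M' ≤ M'' ≤ M' + 2`, `M = M' + M''`. -/
theorem key_ineq {c : ℝ} (hc : 0 ≤ c) {M' M'' M : ℕ} (h2 : 2 ≤ M') (hle : M' ≤ M'') (hle2 : M'' ≤ M' + 2)
    (hM : M' + M'' = M) :
    c / (M' : ℝ) + 6 * c / (M : ℝ) ≤ 6 * c / (M'' : ℝ) := by
  have ha : (2 : ℝ) ≤ M' := by exact_mod_cast h2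
  have hb : (M' : ℝ) ≤ M'' := by exact_mod_cast hle
  have hb2 : (M'' : ℝ) ≤ M' + 2 := by exact_mod_cast hle2
  have hMr : (M : ℝ) = M' + M'' := by exact_mod_cast hM.symm
  have ha0 : (0 : ℝ) < M' := by linarith
  have hb0 : (0 : ℝ) < M'' := by linarith
  have hM0 : (0 : ℝ) < M := by rw [hMr]; linarith
  have p1 : (M' : ℝ) * M'' ≤ M' * (M' + 2) := mul_le_mul_of_nonneg_left hb2 ha0.le
  have p2 : (M'' : ℝ) * M'' ≤ (M' + 2) * (M' + 2) := mul_le_mul hb2 hb2 hb0.le (by linarith)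
  have p3 : 0 ≤ ((M' : ℝ) - 2) * (4 * M' + 2) := mul_nonneg (by linarith) (by linarith)
  have hpoly : ((M' : ℝ) + M'') * M'' + 6 * M' * M'' ≤ 6 * (M' * (M' + M'')) := by nlinarith [p1, p2, p3]
  rw [div_add_div _ _ ha0.ne' hM0.ne', div_le_div_iff₀ (mul_pos ha0 hM0) hb0, hMr]
  have := mul_le_mul_of_nonneg_left hpoly hc
  nlinarith [this, ha0, hb0, hc]

/-! ## The one-width law is monotone in its constants -/

/-- Larger prefactor `Ξ' ≥ Ξ`, smaller amplitude `0 ≤ A' ≤ A`, larger thresholds `R' ≥ max(R,1)`, `L₁' ≥ L₁` weaken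
`LawAt`. (The only place where the ζ-expanded law is opened; `core_mono` is matched against it by unification.) -/
theorem lawAt_mono {U δ : ℝ} {M : ℕ} {Ξ Ξ' A A' : ℝ} {R R' L₁ L₁' : ℕ}
    (h : LawAt U δ M Ξ A R L₁) (hΞ : Ξ ≤ Ξ') (hA : A' ≤ A) (hA' : 0 ≤ A') (hR : R ≤ R')
    (hR1 : 1 ≤ R') (hL : L₁ ≤ L₁') : LawAt U δ M Ξ' A' R' L₁' := by
  dsimp only [LawAt] at h ⊢
  intro L _ _ hLe hML hL₁ Λ _ _ e ψ hψ hGS r hr hrL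
  have key := h L hLe hML (hL.trans hL₁) Λ e ψ hψ hGS r (hR.trans hr)
    (le_trans (Nat.add_le_add_left hR _) hrL)
  have hx : (1 : ℝ) ≤ ((min r.val (L - r.val) : ℕ) : ℝ) := by
    have h1 : 1 ≤ r.val := hR1.trans hr
    have h2 : 1 ≤ L - r.val := by
      have := le_trans (Nat.add_le_add_left hR1 _) hrL
      omega
    exact_mod_cast le_min h1 h2
  have hMr : (0 : ℝ) < (M : ℝ) := by exact_mod_cast Nat.pos_of_ne_zero (NeZero.ne M)
  exact core_mono key hΞ hA hA' hx (Real.sqrt_nonneg _) hMr (Nat.cast_nonneg L) (sq_nonneg _)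

/-- Finite base window: the per-width laws of the even widths in `[Ms, Ms + n)` merge into ONE law with common
constants (max of prefactors and thresholds, min of amplitudes). -/
theorem window_uniform {U δ : ℝ} {M₂ Ms : ℕ}
    (hbase : ∀ M : ℕ, Even M → M₂ ≤ M → ∃ Ξ : ℝ, 0 < Ξ ∧ ∃ A : ℝ, 0 < A ∧ ∃ R L₁ : ℕ, LawAt U δ M Ξ A R L₁)
    (hMs : M₂ ≤ Ms) (n : ℕ) :
    ∃ Ξ : ℝ, 0 < Ξ ∧ ∃ A : ℝ, 0 < A ∧ ∃ R L₁ : ℕ, 1 ≤ R ∧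
      ∀ M : ℕ, Even M → Ms ≤ M → M < Ms + n → LawAt U δ M Ξ A R L₁ := by
  induction n with
  | zero =>
    exact ⟨1, one_pos, 1, one_pos, 1, 0, le_rfl, fun M _ h1 h2 => absurd h2 (by omega)⟩
  | succ n ih =>
    obtain ⟨Ξ, hΞ, A, hA, R, L₁, hR, hlaw⟩ := ih
    by_cases hev : Even (Ms + n)
    · obtain ⟨Ξ', hΞ', A', hA', R', L₁', hlaw'⟩ := hbase (Ms + n) hev (by omega)
      refine ⟨max Ξ Ξ', lt_max_of_lt_left hΞ, min A A', lt_min hA hA', max R R', max L₁ L₁',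
        le_max_of_le_left hR, fun M hMe h1 h2 => ?_⟩
      rcases Nat.lt_or_ge M (Ms + n) with h | h
      · exact lawAt_mono (hlaw M hMe h1 h) (le_max_left _ _) (min_le_left _ _) (le_min hA.le hA'.le)
          (le_max_left _ _) (le_max_of_le_left hR) (le_max_left _ _)
      · have hM : M = Ms + n := by omega
        rw [hM]
        exact lawAt_mono hlaw' (le_max_right _ _) (min_le_right _ _) (le_min hA.le hA'.le)
          (le_max_right _ _) (le_max_of_le_left hR) (le_max_right _ _)
    · refine ⟨Ξ, hΞ, A, hA, R, L₁, hR, fun M hMe h1 h2 => ?_⟩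
      rcases Nat.lt_or_ge M (Ms + n) with h | h
      · exact hlaw M hMe h1 h
      · exfalso
        have hM : M = Ms + n := by omega
        exact hev (hM ▸ hMe)

/-! ## The climb: width-uniform constants from the two stubs -/

/-- THE ASSEMBLY PROPER (no `sorry`): per-width base laws + seam gluing with summable defect ⇒ ONE law with
width-uniform constants for all even widths beyond an even floor `Ms`. Strong induction on the width with the
potential `f(m) = F − 6c/m`. -/
theorem family_of_stubs
    (h1 : ∀ U : ℝ, 0 < U → ∀ δ ∈ Set.Ioo (0 : ℝ) (3 / 10), ∀ (d₀ k₀ : ℝ) (M₁ L₀ : ℕ), 0 < d₀ →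
      UniformThermo U δ d₀ k₀ M₁ L₀ →
        ∃ M₂ : ℕ, ∀ M : ℕ, Even M → M₂ ≤ M →
          ∃ Ξ : ℝ, 0 < Ξ ∧ ∃ A : ℝ, 0 < A ∧ ∃ R L₁ : ℕ, LawAt U δ M Ξ A R L₁)
    (h2 : ∀ U : ℝ, 0 < U → ∀ δ ∈ Set.Ioo (0 : ℝ) (3 / 10), ∀ (d₀ k₀ : ℝ) (M₁ L₀ : ℕ), 0 < d₀ →
      UniformThermo U δ d₀ k₀ M₁ L₀ →
        ∃ c : ℝ, 0 ≤ c ∧ ∃ M₂ R₀ L₂ : ℕ, ∀ M' M'' : ℕ, Even M' → Even M'' → M₂ ≤ M' → M' ≤ M'' →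
          M'' ≤ M' + 2 → ∀ (Ξ A : ℝ) (R L₁ : ℕ), 0 < Ξ → 0 < A → R₀ ≤ R → L₂ ≤ L₁ →
            LawAt U δ M' Ξ A R L₁ → LawAt U δ M'' Ξ A R L₁ →
              LawAt U δ (M' + M'') (Ξ * Real.exp (c / (M' : ℝ))) (A * Real.exp (-(c / (M' : ℝ)))) R L₁) :
    ∀ U : ℝ, 0 < U → ∀ δ ∈ Set.Ioo (0 : ℝ) (3 / 10), ∀ (d₀ k₀ : ℝ) (M₁ L₀ : ℕ), 0 < d₀ →
      UniformThermo U δ d₀ k₀ M₁ L₀ →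
        ∃ Ξ : ℝ, 0 < Ξ ∧ ∃ A : ℝ, 0 < A ∧ ∃ R M₂ L₁ : ℕ,
          ∀ M : ℕ, Even M → M₂ ≤ M → LawAt U δ M Ξ A R L₁ := by
  intro U hU δ hδ d₀ k₀ M₁ L₀ hd₀ hth
  obtain ⟨Ma, hbase⟩ := h1 U hU δ hδ d₀ k₀ M₁ L₀ hd₀ hth
  obtain ⟨c, hc, Mb, R₀, L₂, hglue⟩ := h2 U hU δ hδ d₀ k₀ M₁ L₀ hd₀ hth
  -- an even base floor `Ms ≥ max(Ma, Mb, 2)`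
  obtain ⟨Ms, hMsa, hMsb, hMs2, hMse⟩ : ∃ Ms : ℕ, Ma ≤ Ms ∧ Mb ≤ Ms ∧ 2 ≤ Ms ∧ Even Ms :=
    ⟨max (max Ma Mb) 1 + max (max Ma Mb) 1, by omega, by omega, by omega, ⟨_, rfl⟩⟩
  -- common constants on the base window `[Ms, 2Ms)`
  obtain ⟨Ξw, hΞw, Aw, hAw, Rw, Lw, hRw, hwin⟩ := window_uniform hbase hMsa Ms
  -- thresholds, raised once
  obtain ⟨Rs, hRs⟩ : ∃ Rs : ℕ, Rs = max Rw R₀ := ⟨_, rfl⟩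
  obtain ⟨Ls, hLs⟩ : ∃ Ls : ℕ, Ls = max Lw L₂ := ⟨_, rfl⟩
  have hRs1 : 1 ≤ Rs := by rw [hRs]; exact le_max_of_le_left hRw
  have hRsw : Rw ≤ Rs := by rw [hRs]; exact le_max_left _ _
  have hRs0 : R₀ ≤ Rs := by rw [hRs]; exact le_max_right _ _
  have hLsw : Lw ≤ Ls := by rw [hLs]; exact le_max_left _ _
  have hLs2 : L₂ ≤ Ls := by rw [hLs]; exact le_max_right _ _
  -- the potential `f(m) = F - 6c/m`, `F = 6c/Ms`
  obtain ⟨F, hF⟩ : ∃ F : ℝ, F = 6 * c / (Ms : ℝ) := ⟨_, rfl⟩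
  have hc6 : 0 ≤ 6 * c := by positivity
  have hMs0 : (0 : ℝ) < (Ms : ℝ) := by exact_mod_cast (show 0 < Ms by omega)
  have hf0 : ∀ m : ℕ, Ms ≤ m → 0 ≤ F - 6 * c / (m : ℝ) := by
    intro m hm
    have : 6 * c / (m : ℝ) ≤ 6 * c / (Ms : ℝ) :=
      div_le_div_of_nonneg_left hc6 hMs0 (by exact_mod_cast hm)
    rw [hF]; linarith
  have hfF : ∀ m : ℕ, F - 6 * c / (m : ℝ) ≤ F := fun m => by
    have : 0 ≤ 6 * c / (m : ℝ) := div_nonneg hc6 (Nat.cast_nonneg m)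
    linarith
  have hfmono : ∀ m m' : ℕ, 0 < m → m ≤ m' → F - 6 * c / (m : ℝ) ≤ F - 6 * c / (m' : ℝ) := by
    intro m m' hm hmm'
    have hm0 : (0 : ℝ) < (m : ℝ) := by exact_mod_cast hm
    have : 6 * c / (m' : ℝ) ≤ 6 * c / (m : ℝ) :=
      div_le_div_of_nonneg_left hc6 hm0 (by exact_mod_cast hmm')
    linarith
  -- THE CLIMB (strong induction on the width)
  have hQ : ∀ M : ℕ, Even M → Ms ≤ M →
      LawAt U δ M (Ξw * Real.exp (F - 6 * c / (M : ℝ))) (Aw * Real.exp (-(F - 6 * c / (M : ℝ)))) Rs Ls := by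
    intro M
    induction M using Nat.strong_induction_on with
    | _ M ih =>
      intro hMe hMsM
      rcases Nat.lt_or_ge M (Ms + Ms) with hlt | hge
      · -- base window
        have hw := hwin M hMe hMsM hlt
        refine lawAt_mono hw ?_ ?_ (by positivity) hRsw hRs1 hLsw
        · exact le_mul_of_one_le_right hΞw.le (Real.one_le_exp (hf0 M hMsM))
        · exact mul_le_of_le_one_right hAw.le (Real.exp_le_one_iff.2 (by linarith [hf0 M hMsM]))
      · -- inductive step: `M = M' + M''` with near-equal even parts
        obtain ⟨M', hM'⟩ : ∃ M' : ℕ, M' = 2 * (M / 2 / 2) := ⟨_, rfl⟩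
        obtain ⟨M'', hM''⟩ : ∃ M'' : ℕ, M'' = M - M' := ⟨_, rfl⟩
        obtain ⟨m, hm⟩ := hMe
        obtain ⟨s, hs⟩ := hMse
        have hM'e : Even M' := ⟨M / 2 / 2, by omega⟩
        have hM''e : Even M'' := ⟨m - M / 2 / 2, by omega⟩
        have h1' : Ms ≤ M' := by omega
        have h2' : M' ≤ M'' := by omega
        have h3' : M'' ≤ M' + 2 := by omega
        have h4' : M' + M'' = M := by omega
        have h5' : M' < M := by omega
        have h6' : M'' < M := by omega
        have h7' : 2 ≤ M' := by omega
        have hM'0 : 0 < M' := by omega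
        have hl' := ih M' h5' hM'e h1'
        have hl'' := ih M'' h6' hM''e (h1'.trans h2')
        -- raise the `M'` law to the common potential `f(M'')`
        have hl'w : LawAt U δ M' (Ξw * Real.exp (F - 6 * c / (M'' : ℝ)))
            (Aw * Real.exp (-(F - 6 * c / (M'' : ℝ)))) Rs Ls := by
          refine lawAt_mono hl' ?_ ?_ (by positivity) le_rfl hRs1 le_rfl
          · exact mul_le_mul_of_nonneg_left (Real.exp_le_exp.2 (hfmono M' M'' hM'0 h2')) hΞw.le
          · exact mul_le_mul_of_nonneg_left
              (Real.exp_le_exp.2 (by linarith [hfmono M' M'' hM'0 h2'])) hAw.le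
        -- glue
        have hglued := hglue M' M'' hM'e hM''e (hMsb.trans h1') h2' h3' _ _ Rs Ls
          (by positivity) (by positivity) hRs0 hLs2 hl'w hl''
        rw [h4'] at hglued
        -- budget: `f(M'') + c/M' ≤ f(M)`
        have hkey : F - 6 * c / (M'' : ℝ) + c / (M' : ℝ) ≤ F - 6 * c / (M : ℝ) := by
          have := key_ineq hc h7' h2' h3' h4'
          linarith
        refine lawAt_mono hglued ?_ ?_ (by positivity) le_rfl hRs1 le_rfl
        · rw [mul_assoc, ← Real.exp_add]
          exact mul_le_mul_of_nonneg_left (Real.exp_le_exp.2 hkey) hΞw.le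
        · rw [mul_assoc, ← Real.exp_add]
          exact mul_le_mul_of_nonneg_left (Real.exp_le_exp.2 (by linarith [hkey])) hAw.le
  -- uniform constants
  refine ⟨Ξw * Real.exp F, by positivity, Aw * Real.exp (-F), by positivity, Rs, Ms, Ls, fun M hMe hM => ?_⟩
  refine lawAt_mono (hQ M hMe hM) ?_ ?_ (by positivity) le_rfl hRs1 le_rfl
  · exact mul_le_mul_of_nonneg_left (Real.exp_le_exp.2 (hfF M)) hΞw.le
  · exact mul_le_mul_of_nonneg_left (Real.exp_le_exp.2 (by linarith [hfF M])) hAw.le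

/-! ## The crux, verbatim, from the two stub statements; then BY NAME from the two stubs -/

/-- THE DECOMPOSITION, closed form (kernel-checked, no `sorry`): the two stub statements imply the crux — written out
VERBATIM (the route decl's signature, character for character), so that only `WidthHaldaneBridge_of` below concludes
the route decl BY NAME (skeleton audit (i)/(ii)); the `example` after it certifies that this verbatim statement IS the
route decl (δ/ζ-unfolding only). -/
theorem WidthHaldaneBridge_of_stubs
    (h1 : ∀ U : ℝ, 0 < U → ∀ δ ∈ Set.Ioo (0 : ℝ) (3 / 10), ∀ (d₀ k₀ : ℝ) (M₁ L₀ : ℕ), 0 < d₀ →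
      UniformThermo U δ d₀ k₀ M₁ L₀ →
        ∃ M₂ : ℕ, ∀ M : ℕ, Even M → M₂ ≤ M →
          ∃ Ξ : ℝ, 0 < Ξ ∧ ∃ A : ℝ, 0 < A ∧ ∃ R L₁ : ℕ, LawAt U δ M Ξ A R L₁)
    (h2 : ∀ U : ℝ, 0 < U → ∀ δ ∈ Set.Ioo (0 : ℝ) (3 / 10), ∀ (d₀ k₀ : ℝ) (M₁ L₀ : ℕ), 0 < d₀ →
      UniformThermo U δ d₀ k₀ M₁ L₀ →
        ∃ c : ℝ, 0 ≤ c ∧ ∃ M₂ R₀ L₂ : ℕ, ∀ M' M'' : ℕ, Even M' → Even M'' → M₂ ≤ M' → M' ≤ M'' →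
          M'' ≤ M' + 2 → ∀ (Ξ A : ℝ) (R L₁ : ℕ), 0 < Ξ → 0 < A → R₀ ≤ R → L₂ ≤ L₁ →
            LawAt U δ M' Ξ A R L₁ → LawAt U δ M'' Ξ A R L₁ →
              LawAt U δ (M' + M'') (Ξ * Real.exp (c / (M' : ℝ))) (A * Real.exp (-(c / (M' : ℝ)))) R L₁) :
    open Matrix Literature.MathematicalPhysics.QuantumLattice in let H0 : ∀ (L M : ℕ) (Λ : Type) [LinearOrder Λ] [Fintype Λ], (Λ ≃ ZMod L × ZMod M) → ℝ → Matrix (Finset (Orb Λ)) (Finset (Orb Λ)) ℂ := fun _ _ Λ _ _ e U => hamiltonian (SimpleGraph.fromRel fun x y : Λ => y = e.symm ((e x).1 + 1, (e x).2) ∨ y = e.symm ((e x).1, (e x).2 + 1)) 1 U; let Tw : ∀ (L M : ℕ) [NeZero L] [NeZero M] (Λ : Type) [LinearOrder Λ] [Fintype Λ], (Λ ≃ ZMod L × ZMod M) → ℝ → Matrix (Finset (Orb Λ)) (Finset (Orb Λ)) ℂ := fun _ M _ _ _ _ _ e θ => ∑ b : ZMod M, ∑ σ : Fin 2, ((1 -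 Complex.exp (Complex.I * θ)) • (creation (orb (e.symm (0, b)) σ) * annihilation (orb (e.symm (-1, b)) σ)) + (1 - Complex.exp (-(Complex.I * θ))) • (creation (orb (e.symm (-1, b)) σ) * annihilation (orb (e.symm (0, b)) σ))); let E : ∀ (L M : ℕ) [NeZero L] [NeZero M] (Λ : Type) [LinearOrder Λ] [Fintype Λ], (Λ ≃ ZMod L × ZMod M) → ℝ → ℝ → ℕ → ℝ := fun L M _ _ Λ _ _ e U θ N => (H0 L M Λ e U + Tw L M Λ e θ).minEnergyOn (szSector N 0); let Np : ℕ → ℕ → ℝ → ℕ := fun L M δ => 2 * ⌊(1 - δ) * ((L : ℝ) * (M : ℝ)) / 2⌋₊; let stiff : ∀ (L M : ℕ) [NeZero L] [NeZero M] (Λ : Type) [LinearOrder Λ] [Fintype Λ], (Λ ≃ ZMod L × ZMod M) → ℝ → ℝ → ℝ := fun L M _ _ Λ _ _ e U δ => 2 * (L : ℝ) * (E L M Λ e U (Real.pi / 3) (Np L M δ) - E L M Λ e U 0 (Np L M δ)) / ((Real.pi / 3) ^ 2 * (M : ℝ)); let icomp : ∀ (L M : ℕ) [NeZero L] [NeZero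 M] (Λ : Type) [LinearOrder Λ] [Fintype Λ], (Λ ≃ ZMod L × ZMod M) → ℝ → ℝ → ℝ := fun L M _ _ Λ _ _ e U δ => (L : ℝ) * (M : ℝ) * (E L M Λ e U 0 (Np L M δ + 2) + E L M Λ e U 0 (Np L M δ - 2) - 2 * E L M Λ e U 0 (Np L M δ)) / 4; let P : ∀ (L M : ℕ) (Λ : Type) [LinearOrder Λ] [Fintype Λ], (Λ ≃ ZMod L × ZMod M) → Λ → Matrix (Finset (Orb Λ)) (Finset (Orb Λ)) ℂ := fun _ _ Λ _ _ e x => ∑ j : Fin 4, (((![1, 1, -1, -1] : Fin 4 → ℝ) j / Real.sqrt 2 : ℝ) : ℂ) • (annihilation (orb x 0) * annihilation (orb ((![e.symm ((e x).1 + 1, (e x).2), e.symm ((e x).1 - 1, (e x).2), e.symm ((e x).1, (e x).2 + 1), e.symm ((e x).1, (e x).2 - 1)] : Fin 4 → Λ) j) 1) - annihilation (orb x 1) * annihilation (orb ((![e.symm ((e x).1 + 1, (e x).2), e.symm ((e x).1 - 1, (e x).2), e.symm ((e x).1, (e x).2 + 1), e.symm ((e x).1, (e x).2 - 1)] : Fin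 4 → Λ) j) 0)); let G : ∀ (L M : ℕ) [NeZero L] [NeZero M] (Λ : Type) [LinearOrder Λ] [Fintype Λ], (Λ ≃ ZMod L × ZMod M) → Fock (Orb Λ) → ZMod L → ℝ := fun L M _ _ Λ _ _ e ψ r => ∑ a : ZMod L, (expect ((∑ b : ZMod M, P L M Λ e (e.symm (a, b)))ᴴ * (∑ b : ZMod M, P L M Λ e (e.symm (a + r, b)))) ψ).re; ∀ U : ℝ, 0 < U → ∀ δ ∈ Set.Ioo (0 : ℝ) (3 / 10), ∀ (d₀ k₀ : ℝ) (M₁ L₀ : ℕ), 0 < d₀ → (∀ (L M : ℕ) [NeZero L] [NeZero M], Even L → Even M → M₁ ≤ M → M ≤ L → L₀ ≤ L → ∀ (Λ : Type) [LinearOrder Λ] [Fintype Λ] (e : Λ ≃ ZMod L × ZMod M), d₀ ≤ stiff L M Λ e U δ ∧ 0 < icomp L M Λ e U δ ∧ icomp L M Λ e U δ ≤ k₀) → ∃ Ξ : ℝ, 0 < Ξ ∧ ∃ A : ℝ, 0 < A ∧ ∃ R M₂ L₁ : ℕ, ∀ (L M : ℕ) [NeZero L] [NeZero M], Even L → Even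 M → M₂ ≤ M → M ≤ L → L₁ ≤ L → ∀ (Λ : Type) [LinearOrder Λ] [Fintype Λ] (e : Λ ≃ ZMod L × ZMod M), ∀ ψ : Fock (Orb Λ), star ψ ⬝ᵥ ψ = 1 → IsGroundStateInSector (H0 L M Λ e U) (Np L M δ) 0 ψ → ∀ r : ZMod L, R ≤ r.val → r.val + R ≤ L → A * (L : ℝ) * (M : ℝ) ^ 2 * ((min r.val (L - r.val) : ℕ) : ℝ) ^ (-(Ξ * Real.sqrt (icomp L M Λ e U δ / stiff L M Λ e U δ) / (M : ℝ))) ≤ G L M Λ e ψ r := by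
  have hfam := family_of_stubs h1 h2
  dsimp only
  intro U hU δ hδ d₀ k₀ M₁ L₀ hd₀ hth
  obtain ⟨Ξ, hΞ, A, hA, R, M₂, L₁, hlaw⟩ :=
    hfam U hU δ hδ d₀ k₀ M₁ L₀ hd₀ (by dsimp only [UniformThermo]; exact hth)
  refine ⟨Ξ, hΞ, A, hA, R, M₂, L₁, ?_⟩
  intro L M _ _ hLe hMe hM hML hL Λ _ _ e ψ hψ hGS r hr hrL
  have key := hlaw M hMe hM
  dsimp only [LawAt] at key
  exact key L hLe hML hL Λ e ψ hψ hGS r hr hrL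

/-- Certificate: the verbatim statement of `WidthHaldaneBridge_of_stubs` IS the route decl
`Summit.HubbardSuperconductivity.HubbardSuperconductivity.Theses.WidthHaldane.WidthHaldaneBridge` (by `δ`). -/
example
    (h1 : ∀ U : ℝ, 0 < U → ∀ δ ∈ Set.Ioo (0 : ℝ) (3 / 10), ∀ (d₀ k₀ : ℝ) (M₁ L₀ : ℕ), 0 < d₀ →
      UniformThermo U δ d₀ k₀ M₁ L₀ →
        ∃ M₂ : ℕ, ∀ M : ℕ, Even M → M₂ ≤ M →
          ∃ Ξ : ℝ, 0 < Ξ ∧ ∃ A : ℝ, 0 < A ∧ ∃ R L₁ : ℕ, LawAt U δ M Ξ A R L₁)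
    (h2 : ∀ U : ℝ, 0 < U → ∀ δ ∈ Set.Ioo (0 : ℝ) (3 / 10), ∀ (d₀ k₀ : ℝ) (M₁ L₀ : ℕ), 0 < d₀ →
      UniformThermo U δ d₀ k₀ M₁ L₀ →
        ∃ c : ℝ, 0 ≤ c ∧ ∃ M₂ R₀ L₂ : ℕ, ∀ M' M'' : ℕ, Even M' → Even M'' → M₂ ≤ M' → M' ≤ M'' →
          M'' ≤ M' + 2 → ∀ (Ξ A : ℝ) (R L₁ : ℕ), 0 < Ξ → 0 < A → R₀ ≤ R → L₂ ≤ L₁ →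
            LawAt U δ M' Ξ A R L₁ → LawAt U δ M'' Ξ A R L₁ →
              LawAt U δ (M' + M'') (Ξ * Real.exp (c / (M' : ℝ))) (A * Real.exp (-(c / (M' : ℝ)))) R L₁) :
    WidthHaldaneBridge :=
  WidthHaldaneBridge_of_stubs h1 h2

/-- SKELETON THEOREM: the crux BY NAME from the two registered stubs (both open; `sorryAx` enters only through
`stub_perWidthHaldaneLaw` and `stub_seamGluing`). -/
theorem WidthHaldaneBridge_of : WidthHaldaneBridge :=
  WidthHaldaneBridge_of_stubs stub_perWidthHaldaneLaw stub_seamGluing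

end Summit.HubbardSuperconductivity.HubbardSuperconductivity.Cruxes.WidthHaldaneBridge.Birth
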